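import Mathlib.RingTheory.MvPolynomial.EulerIdentity
import Summits.Schanuel.Schanuel.Theorems.ZilberEacComplexHypersurfaceEscapeCorollaries
import HarnessLib

/-!
# Linear escape over hypersurface bases: rational lattice directions; real quadratic leading forms

Two further corollaries of Theorem H_esc (`ZilberEacComplexHypersurfaceEscape.lean`; Exponential-Algebraic
Closedness over an arbitrary hypersurface base `{H = 0} ⊆ ℂⁿ` for Laurent-parametrised escape fibres;
first open rung `dim π₁(V) = n - 1`, Mantova–Masser, PLMS 129 (2024), §1 p. 5):

* `exists_expPoint_hypersurfaceEscape_rat` — the lattice direction may be RATIONAL: a simple root `λ`,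
  `Re λ ≠ 0`, of `H_D(λν + 2πi q/k)` (`q ∈ ℤⁿ`, `k ≥ 1`) suffices (scaling `(λ, q/k) ↦ (kλ, q)` and
  homogeneity). This is the form in which the density remark of the corollaries file applies;
* `exists_expPoint_realQuadricEscape` — **real symmetric quadratic leading form with an elliptic pair**:
  base `Σᵢⱼ Mᵢⱼxᵢxⱼ + Σ bᵢxᵢ + c₀ = 0` (`M` real symmetric, `b, c₀` complex), fibre direction `ν`, and an
  integer vector `q` with `B(ν,q)² < Q(ν)Q(q)` (`Q(x) = Σ Mᵢⱼxᵢxⱼ`, `B(ν,q) = Σ Mᵢⱼνᵢqⱼ`): then EC for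
  every escape family, the simple root being `λ = -(2π/Q(ν))(√(Q(ν)Q(q) - B²) + iB)`. Positive-definite
  `M` (ellipsoids, `ZilberEacComplexEllipsoidEscape.lean`) admit such `q` for every `ν ≠ 0` (`n ≥ 2`,
  Cauchy–Schwarz); indefinite `M` do exactly when `ν` is not a hyperbolicity direction.

HONEST FRAMING: modest sub-rungs of EAC; nothing here bears on Schanuel's conjecture; EC(3,2) open.
-/

noncomputable section

open Complex MvPolynomial Metric Set Filter Topology

set_option linter.dupNamespace false

namespace Summit.Schanuel.Schanuel.Theorems

/-- **Rational lattice directions.** Theorem H_esc with `v = λν + 2πi q/k` (`q ∈ ℤⁿ`, `k ≥ 1`) and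
`Re λ ≠ 0`: by homogeneity `H_D(k v) = kᴰ H_D(v)`, `∂ᵢH_D(kv) = k^{D-1} ∂ᵢH_D(v)`, and
`k v = (kλ)ν + 2πiq` is an integral lattice datum. [cite: MantovaMasser2023, §1 p.5 (the open case
dim π(V) = 2 in ℂ³×ℂˣ³)] -/
theorem exists_expPoint_hypersurfaceEscape_rat {n : ℕ} (H : MvPolynomial (Fin n) ℂ)
    (hD : 1 ≤ H.totalDegree) (ν q : Fin n → ℤ) (k : ℕ) (hk : 0 < k) (lam : ℂ) (hre : lam.re ≠ 0)
    (hroot : eval (fun i => lam * (ν i : ℂ) + 2 * Real.pi * I * (q i : ℂ) / k)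
      (homogeneousComponent H.totalDegree H) = 0)
    (hβ : ∑ i, (ν i : ℂ) * eval (fun i => lam * (ν i : ℂ) + 2 * Real.pi * I * (q i : ℂ) / k)
      (pderiv i (homogeneousComponent H.totalDegree H)) ≠ 0)
    (c : Fin n → ℂ) (hc : ∀ i, c i ≠ 0) (S : Fin n → Finset ℤ) (hS : ∀ i, ∀ m ∈ S i, m < ν i)
    (A : Fin n → ℤ → MvPolynomial (Fin n) ℂ) :
    ∃ x : Fin n → ℂ, ∃ L : ℂ, eval x H = 0 ∧ ∀ i,
      exp (x i) = c i * exp ((ν i : ℂ) * L) + ∑ m ∈ S i, eval x (A i m) * exp ((m : ℂ) * L) := by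
  have hkC : (k : ℂ) ≠ 0 := by exact_mod_cast hk.ne'
  have hhom : (homogeneousComponent H.totalDegree H).IsHomogeneous H.totalDegree :=
    homogeneousComponent_isHomogeneous _ H
  have hv' : (fun i => (k : ℂ) * lam * (ν i : ℂ) + 2 * Real.pi * I * (q i : ℂ)) =
      (k : ℂ) • (fun i => lam * (ν i : ℂ) + 2 * Real.pi * I * (q i : ℂ) / k) := by
    funext i; simp only [Pi.smul_apply, smul_eq_mul]; field_simp
  refine exists_expPoint_hypersurfaceEscape_of_re_ne_zero H hD ν q ((k : ℂ) * lam) ?_ ?_ ?_ c hc S hS A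
  · rw [show ((k : ℂ) * lam).re = (k : ℝ) * lam.re by simp]
    exact mul_ne_zero (by exact_mod_cast hk.ne') hre
  · rw [hv', hhom.eval_smul_eq, hroot, mul_zero]
  · rw [hv']
    simp_rw [hhom.pderiv.eval_smul_eq]
    have : ∑ i, (ν i : ℂ) * ((k : ℂ) ^ (H.totalDegree - 1) *
        eval (fun i => lam * (ν i : ℂ) + 2 * Real.pi * I * (q i : ℂ) / k)
          (pderiv i (homogeneousComponent H.totalDegree H))) =
        (k : ℂ) ^ (H.totalDegree - 1) * ∑ i, (ν i : ℂ) *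
          eval (fun i => lam * (ν i : ℂ) + 2 * Real.pi * I * (q i : ℂ) / k)
            (pderiv i (homogeneousComponent H.totalDegree H)) := by
      rw [Finset.mul_sum]; exact Finset.sum_congr rfl fun i _ => by ring
    rw [this]
    exact mul_ne_zero (pow_ne_zero _ hkC) hβ

/-- **EC over real quadrics with an elliptic lattice pair, no further hypothesis.** Let `M` be a real
SYMMETRIC `n × n` matrix, `b ∈ ℂⁿ`, `c₀ ∈ ℂ`, `Q(x) = Σᵢⱼ Mᵢⱼxᵢxⱼ`; let `ν, q ∈ ℤⁿ` with
`B(ν,q)² < Q(ν) Q(q)`, `B(ν,q) = Σᵢⱼ Mᵢⱼνᵢqⱼ` (so `μ ↦ Q(μν + q)` has non-real roots: an "elliptic pair";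
for positive-definite `M` every `q ∦ ν` works, for Lorentzian `M` one needs `ν` outside the light cone's
hyperbolicity directions). Then for all `cᵢ ≠ 0`, finite `Sᵢ ⊆ ℤ` below `νᵢ` and arbitrary
`A_{i,m} ∈ ℂ[x]` there are `x` on the quadric `Q(x) + Σ bᵢxᵢ + c₀ = 0` and `L` with
`e^{xᵢ} = cᵢ e^{νᵢL} + Σ_{m∈Sᵢ} A_{i,m}(x) e^{mL}` (Theorem H_esc with the explicit simple root
`λ = -(2π/Q(ν))(√(Q(ν)Q(q) - B²) + iB)`, `Re λ ≠ 0`, `Σ νₖ∂ₖQ(v) = -4π√(…) ≠ 0`). New.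
[cite: MantovaMasser2023, §1 p.5 (the open case dim π(V) = 2 in ℂ³×ℂˣ³)] -/
theorem exists_expPoint_realQuadricEscape {n : ℕ} (M : Fin n → Fin n → ℝ) (hM : ∀ i j, M i j = M j i)
    (b : Fin n → ℂ) (c₀ : ℂ) (ν q : Fin n → ℤ)
    (hdisc : (∑ i, ∑ j, M i j * (ν i : ℝ) * (q j : ℝ)) ^ 2 <
      (∑ i, ∑ j, M i j * (ν i : ℝ) * (ν j : ℝ)) * (∑ i, ∑ j, M i j * (q i : ℝ) * (q j : ℝ)))
    (c : Fin n → ℂ) (hc : ∀ i, c i ≠ 0) (S : Fin n → Finset ℤ) (hS : ∀ i, ∀ m ∈ S i, m < ν i)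
    (A : Fin n → ℤ → MvPolynomial (Fin n) ℂ) :
    ∃ x : Fin n → ℂ, ∃ L : ℂ,
      (∑ i, ∑ j, (M i j : ℂ) * x i * x j + ∑ i, b i * x i + c₀ = 0) ∧ ∀ i,
        exp (x i) = c i * exp ((ν i : ℂ) * L) + ∑ m ∈ S i, eval x (A i m) * exp ((m : ℂ) * L) := by
  classical
  set Qν : ℝ := ∑ i, ∑ j, M i j * (ν i : ℝ) * (ν j : ℝ) with hQν
  set Qq : ℝ := ∑ i, ∑ j, M i j * (q i : ℝ) * (q j : ℝ) with hQq
  set B : ℝ := ∑ i, ∑ j, M i j * (ν i : ℝ) * (q j : ℝ) with hB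
  have hQν0 : Qν ≠ 0 := by
    intro h; rw [h, zero_mul] at hdisc; nlinarith [sq_nonneg B]
  set Δ : ℝ := Qν * Qq - B ^ 2 with hΔ
  have hΔ0 : 0 < Δ := by rw [hΔ]; linarith
  set s : ℝ := Real.sqrt Δ with hs
  have hspos : 0 < s := Real.sqrt_pos.mpr hΔ0
  have hssq : s ^ 2 = Δ := by rw [sq]; exact Real.mul_self_sqrt hΔ0.le
  set k : ℝ := 2 * Real.pi / Qν with hk
  have hk0 : k ≠ 0 := div_ne_zero (by positivity) hQν0
  have hkQ : (k : ℂ) * (Qν : ℂ) = 2 * Real.pi := by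
    rw [← Complex.ofReal_mul, hk, div_mul_cancel₀ _ hQν0]; push_cast; ring
  have hkey : (s : ℂ) ^ 2 + (B : ℂ) ^ 2 = (Qν : ℂ) * (Qq : ℂ) := by
    have h : s ^ 2 + B ^ 2 = Qν * Qq := by rw [hssq, hΔ]; ring
    exact_mod_cast h
  -- the base polynomial
  set QF : MvPolynomial (Fin n) ℂ := ∑ i, ∑ j, C (M i j : ℂ) * X i * X j with hQF
  set Lin : MvPolynomial (Fin n) ℂ := ∑ i, C (b i) * X i + C c₀ with hLin
  set H : MvPolynomial (Fin n) ℂ := QF + Lin with hH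
  have hQFhom : QF.IsHomogeneous 2 := by
    rw [hQF]
    refine IsHomogeneous.sum _ _ _ fun i _ => IsHomogeneous.sum _ _ _ fun j _ => ?_
    simpa using ((isHomogeneous_C (Fin n) (M i j : ℂ)).mul (isHomogeneous_X ℂ i)).mul
      (isHomogeneous_X ℂ j)
  have hLinhom1 : (∑ i, C (b i) * X i : MvPolynomial (Fin n) ℂ).IsHomogeneous 1 := by
    refine IsHomogeneous.sum _ _ _ fun i _ => ?_
    simpa using (isHomogeneous_C (Fin n) (b i)).mul (isHomogeneous_X ℂ i)
  have hevalQF : ∀ x : Fin n → ℂ, eval x QF = ∑ i, ∑ j, (M i j : ℂ) * x i * x j := fun x => by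
    simp [hQF, map_sum, map_mul, eval_C, eval_X]
  have hevalH : ∀ x : Fin n → ℂ,
      eval x H = ∑ i, ∑ j, (M i j : ℂ) * x i * x j + ∑ i, b i * x i + c₀ := fun x => by
    simp only [hH, hLin, map_add, hevalQF, map_sum, map_mul, eval_C, eval_X]
    ring
  have hQνC : (∑ i, ∑ j, (M i j : ℂ) * (ν i : ℂ) * (ν j : ℂ)) = (Qν : ℂ) := by
    rw [hQν]; push_cast; rfl
  have hQqC : (∑ i, ∑ j, (M i j : ℂ) * (q i : ℂ) * (q j : ℂ)) = (Qq : ℂ) := by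
    rw [hQq]; push_cast; rfl
  have hBC : (∑ i, ∑ j, (M i j : ℂ) * (ν i : ℂ) * (q j : ℂ)) = (B : ℂ) := by
    rw [hB]; push_cast; rfl
  -- symmetry: `Σ Mᵢⱼ qᵢ νⱼ = B`
  have hsymB : (∑ i, ∑ j, (M i j : ℂ) * (q i : ℂ) * (ν j : ℂ)) = (B : ℂ) := by
    rw [← hBC, Finset.sum_comm]
    exact Finset.sum_congr rfl fun i _ => Finset.sum_congr rfl fun j _ => by rw [hM j i]; ring
  have hQF0 : QF ≠ 0 := by
    intro h
    have := hevalQF fun i => (ν i : ℂ)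
    rw [h, map_zero, hQνC] at this
    exact hQν0 (by exact_mod_cast this.symm)
  have hQFdeg : QF.totalDegree = 2 := hQFhom.totalDegree hQF0
  have hLindeg : Lin.totalDegree ≤ 1 := by
    rw [hLin]
    refine (totalDegree_add _ _).trans (max_le hLinhom1.totalDegree_le ?_)
    rw [totalDegree_C]; norm_num
  have hHdeg : H.totalDegree = 2 := by
    rw [hH, totalDegree_add_eq_left_of_totalDegree_lt, hQFdeg]
    rw [hQFdeg]; omega
  have hHD : homogeneousComponent H.totalDegree H = QF := by
    rw [hHdeg, hH, map_add, homogeneousComponent_eq_self hQFhom, hLin, map_add,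
      homogeneousComponent_of_mem hLinhom1, homogeneousComponent_of_mem (isHomogeneous_C (Fin n) c₀)]
    simp
  have hpd : ∀ l x, eval x (pderiv l QF) = 2 * ∑ j, (M l j : ℂ) * x j := by
    intro l x
    have key : ∀ i j, eval x (pderiv l (C (M i j : ℂ) * X i * X j)) =
        (M i j : ℂ) * (if i = l then x j else 0) + (M i j : ℂ) * (if j = l then x i else 0) := by
      intro i j
      rw [mul_assoc, pderiv_C_mul, map_mul, eval_C, Derivation.leibniz, pderiv_X, pderiv_X]
      simp only [smul_eq_mul, map_add, map_mul, eval_X]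
      by_cases hi : i = l <;> by_cases hj : j = l
      · subst hi; subst hj; simp [mul_add]
      · subst hi; simp [hj]
      · subst hj; simp [hi]
      · simp [hi, hj]
    have h1 : ∑ i, ∑ j, (M i j : ℂ) * (if i = l then x j else 0) = ∑ j, (M l j : ℂ) * x j := by
      rw [Finset.sum_eq_single l]
      · simp
      · intro i _ hi; simp [hi]
      · intro h; exact absurd (Finset.mem_univ l) h
    have h2 : ∑ i, ∑ j, (M i j : ℂ) * (if j = l then x i else 0) = ∑ j, (M l j : ℂ) * x j := by
      have : ∀ i, ∑ j, (M i j : ℂ) * (if j = l then x i else 0) = (M l i : ℂ) * x i := by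
        intro i
        rw [Finset.sum_eq_single l]
        · simp [hM i l]
        · intro j _ hj; simp [hj]
        · intro h; exact absurd (Finset.mem_univ l) h
      simp only [this]
    rw [hQF]
    simp only [map_sum, key, Finset.sum_add_distrib, h1, h2]
    ring
  -- the root
  set lam : ℂ := -(k : ℂ) * ((s : ℂ) + I * (B : ℂ)) with hlam
  have hre : lam.re ≠ 0 := by
    have : lam.re = -(k * s) := by simp [hlam, Complex.mul_re]
    rw [this, neg_ne_zero]; exact mul_ne_zero hk0 hspos.ne'
  set v : Fin n → ℂ := fun i => lam * (ν i : ℂ) + 2 * Real.pi * I * (q i : ℂ) with hv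
  have hQv : eval v QF = (Qν : ℂ) * lam ^ 2 + 4 * Real.pi * I * (B : ℂ) * lam -
      4 * Real.pi ^ 2 * (Qq : ℂ) := by
    rw [hevalQF]
    have : ∀ i j, (M i j : ℂ) * v i * v j = (M i j : ℂ) * (ν i : ℂ) * (ν j : ℂ) * lam ^ 2 +
        2 * Real.pi * I * lam * ((M i j : ℂ) * (ν i : ℂ) * (q j : ℂ)) +
        2 * Real.pi * I * lam * ((M i j : ℂ) * (q i : ℂ) * (ν j : ℂ)) +
        (2 * Real.pi * I) ^ 2 * ((M i j : ℂ) * (q i : ℂ) * (q j : ℂ)) := by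
      intro i j; simp only [hv]; ring
    simp only [this, Finset.sum_add_distrib, ← Finset.sum_mul, ← Finset.mul_sum, hQνC, hQqC, hBC,
      hsymB]
    linear_combination (4 * (Real.pi : ℂ) ^ 2 * (Qq : ℂ)) * I_sq
  have hroot : eval (fun i => lam * (ν i : ℂ) + 2 * Real.pi * I * (q i : ℂ))
      (homogeneousComponent H.totalDegree H) = 0 := by
    rw [hHD]
    change eval v QF = 0
    rw [hQv, hlam]
    linear_combination ((k : ℂ) * ((s : ℂ) + I * (B : ℂ)) ^ 2 + 2 * Real.pi * (Qq : ℂ)) * hkQ +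
      (2 * Real.pi * (k : ℂ)) * hkey + (-(2 * Real.pi * (k : ℂ) * (B : ℂ) ^ 2)) * I_sq
  have hβ : ∑ i, (ν i : ℂ) * eval (fun i => lam * (ν i : ℂ) + 2 * Real.pi * I * (q i : ℂ))
      (pderiv i (homogeneousComponent H.totalDegree H)) ≠ 0 := by
    rw [hHD]
    change ∑ i, (ν i : ℂ) * eval v (pderiv i QF) ≠ 0
    simp only [hpd]
    have e1 : ∑ l, (ν l : ℂ) * (2 * ∑ j, (M l j : ℂ) * v j) =
        2 * (lam * (Qν : ℂ) + 2 * Real.pi * I * (B : ℂ)) := by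
      rw [← hQνC, ← hBC]
      simp only [hv, Finset.mul_sum, mul_add, Finset.sum_add_distrib]
      congr 1 <;> exact Finset.sum_congr rfl fun i _ => Finset.sum_congr rfl fun j _ => by ring
    have e2 : 2 * (lam * (Qν : ℂ) + 2 * Real.pi * I * (B : ℂ)) = -(4 * Real.pi * (s : ℂ)) := by
      rw [hlam]; linear_combination (-2 * ((s : ℂ) + I * (B : ℂ))) * hkQ
    rw [e1, e2, neg_ne_zero]
    have hπ : (Real.pi : ℂ) ≠ 0 := by exact_mod_cast Real.pi_pos.ne'
    have hsC : (s : ℂ) ≠ 0 := by exact_mod_cast hspos.ne'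
    exact mul_ne_zero (mul_ne_zero (by norm_num) hπ) hsC
  obtain ⟨x, L, hxH, hx⟩ := exists_expPoint_hypersurfaceEscape_of_re_ne_zero H (by rw [hHdeg]; norm_num)
    ν q lam hre hroot hβ c hc S hS A
  refine ⟨x, L, ?_, hx⟩
  rw [← hevalH x, hxH]

end Summit.Schanuel.Schanuel.Theorems
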